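import Mathlib
import Literature.Analysis.FluidPDE.VectorCalculus
import Literature.Analysis.FluidPDE.Ferrari1993EnergyIdentity
import Summits.NavierStokesRegularity.NavierStokesRegularity.Theorems.ThreadingFluxErtelTowerStrainShadowFrame
import HarnessLib

/-!
# Crux `PoloidalLiouville` (stmt-NavierStokesRegularity-1222, W1), crux idea «radial-jerk-tower» (ns-idea-15 g7):
# THE TOWER-CLOSURE LEMMA — rank `≤ 2` of the radial-jerk tower is propagated by its own recursion

Support file (`--supports stmt-NavierStokesRegularity-1222`, helper).  Experiment cell `ns-wall-extremal`, width hand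
ns-wall-eng-5 g7, menu item (δ) (critic ns-wall-crit-1 g5 batch #33: «NO STRIKE, size M, rank 1 — the certification tool
any future closed-form witness against `PotentialJerkRigidity` needs AND a clean structural fact about the radial-jerk
tower; state `G`, `F_k` on all of `ℝ²`»).  0 kit.

For a STEADY smooth drift `u` on an open set `U` and any centre `x₀`, the radial-jerk tower `θ₀ = ½‖x − x₀‖²`,
`θ_{k+1} = ⟪u, ∇θ_k⟫` (`radialJerk (fun _ => u) x₀ k 0`; the `∂ₜ` term of `radialJerk` vanishes for a steady drift,
`radialJerk_steady`) satisfies: if its LEVEL TWO closes over the first two levels,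

  `θ₂ = G ∘ (θ₀, θ₁)` on `U` for some `G ∈ C^∞(ℝ²)`,

then EVERY level closes (`θ_k = F_k ∘ (θ₀, θ₁)` with `F₀ = s`, `F_{k+1}(s,t) = ∂_sF_k·t + ∂_tF_k·G(s,t)`, all `C^∞` on `ℝ²`),
every gradient lies in the plane `span{∇θ₀, ∇θ₁}` (chain rule), and therefore ALL the minors
`⟪∇θ_j, ∇θ_k × ∇θ_l⟫` of the hypothesis of `PotentialJerkRigidity` vanish on `U`
(★ `radialJerk_minors_eq_zero_of_levelTwo`; potential drifts on a ball: `potentialJerk_minors_eq_zero_of_levelTwo`).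

This is the «⟸» half of the reformulation «rank ≤ 2 ⟺ one universal radial ODE ρ″ = G(ρ, ρ′) along the drift's
integral curves» (HOME note POTENTIAL-JERK-NOTE §1), as a kernel theorem.  It certifies closed-form candidates: to exhibit
the full (all `j,k,l`) hypothesis of `PotentialJerkRigidity` for an explicit harmonic `h` it suffices to produce ONE smooth
`G` with `T|∇h|² = G(½|x−x₀|², Eh)` on the ball (`θ₁ = Eh`, `θ₂ = T|∇h|²`, `T = 1 + ½E`).  No such `h` is claimed here.

* `radialJerk_steady`, `radialJerk_succ_steady`, `contDiffOn_radialJerk_steady` (steady-drift bookkeeping);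
* `gradient_eq_of_comp₂` (chain rule: `f = F ∘ (a, b)` near `x` ⇒ `∇f x = ∂₁F·∇a x + ∂₂F·∇b x`);
* `inner_cross_of_span` (three vectors in a plane have zero triple product);
* `radialJerk_levelClosure` (the induction), ★ `radialJerk_minors_eq_zero_of_levelTwo`, `potentialJerk_minors_eq_zero_of_levelTwo`.

BOOKING: structural helper about the sketch's object `radialJerk`; information-grade; W1/W2 movement 0; proves or refutes no
typed Prop.  `PoloidalLiouville` (1222) / (27585) OPEN; NS regularity NOT proved.
-/

-- the summit and its single problem share the name (D-0017 nested layout)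
set_option linter.dupNamespace false

noncomputable section

namespace Summit.NavierStokesRegularity.NavierStokesRegularity.Theorems.PoloidalLiouville.ErtelTower

open Set Function Filter Topology Metric
open scoped Topology RealInnerProductSpace InnerProductSpace
open Literature.Analysis.FluidPDE
open Summit.NavierStokesRegularity.NavierStokesRegularity.Theorems.PoloidalLiouville.HorizonTower (E3)

section TowerClosure

variable {u : E3 → E3} {x₀ : E3} {U : Set E3}

/-- For a STEADY drift the tower does not depend on the time slot. -/
theorem radialJerk_steady (u : E3 → E3) (x₀ : E3) :
    ∀ (k : ℕ) (s t : ℝ), radialJerk (fun _ : ℝ => u) x₀ k s = radialJerk (fun _ : ℝ => u) x₀ k t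
  | 0, _, _ => rfl
  | k + 1, s, t => by
      have ih : ∀ r r' : ℝ, radialJerk (fun _ : ℝ => u) x₀ k r = radialJerk (fun _ : ℝ => u) x₀ k r' :=
        radialJerk_steady u x₀ k
      funext x
      show deriv (fun r => radialJerk (fun _ : ℝ => u) x₀ k r x) s
            + inner ℝ (u x) (gradient (radialJerk (fun _ : ℝ => u) x₀ k s) x)
          = deriv (fun r => radialJerk (fun _ : ℝ => u) x₀ k r x) t
            + inner ℝ (u x) (gradient (radialJerk (fun _ : ℝ => u) x₀ k t) x)
      have hconst : (fun r : ℝ => radialJerk (fun _ : ℝ => u) x₀ k r x)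
          = fun _ => radialJerk (fun _ : ℝ => u) x₀ k 0 x := by
        funext r; rw [ih r 0]
      rw [hconst]
      simp only [deriv_const]
      rw [ih s t]

/-- The steady recursion: `θ_{k+1} = ⟪u, ∇θ_k⟫` (the `∂ₜ` term vanishes). -/
theorem radialJerk_succ_steady (u : E3 → E3) (x₀ : E3) (k : ℕ) (x : E3) :
    radialJerk (fun _ : ℝ => u) x₀ (k + 1) 0 x
      = inner ℝ (u x) (gradient (radialJerk (fun _ : ℝ => u) x₀ k 0) x) := by
  show deriv (fun r => radialJerk (fun _ : ℝ => u) x₀ k r x) 0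
        + inner ℝ (u x) (gradient (radialJerk (fun _ : ℝ => u) x₀ k 0) x) = _
  have hconst : (fun r : ℝ => radialJerk (fun _ : ℝ => u) x₀ k r x)
      = fun _ => radialJerk (fun _ : ℝ => u) x₀ k 0 x := by
    funext r; rw [radialJerk_steady u x₀ k r 0]
  rw [hconst, deriv_const, zero_add]

/-- Every level of the steady tower is smooth on `U` when the drift is. -/
theorem contDiffOn_radialJerk_steady (hU : IsOpen U) (hu : ContDiffOn ℝ (⊤ : ℕ∞) u U) (x₀ : E3) (k : ℕ) :
    ContDiffOn ℝ (⊤ : ℕ∞) (radialJerk (fun _ : ℝ => u) x₀ k 0) U := by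
  have hu' : ContDiffOn ℝ (⊤ : ℕ∞) (Function.uncurry (fun _ : ℝ => u)) ((Set.univ : Set ℝ) ×ˢ U) :=
    hu.comp contDiffOn_snd fun p hp => hp.2
  exact contDiffOn_slice (contDiffOn_radialJerk hu' isOpen_univ hU x₀ k) (Set.mem_univ (0 : ℝ))

/-- **Chain rule for a function closing over two others.**  If `f = F ∘ (a, b)` near `x` with `F` differentiable at
`(a x, b x)` and `a, b` differentiable at `x`, then `∇f x = ∂₁F · ∇a x + ∂₂F · ∇b x` (partials of `F` at `(a x, b x)`). -/
theorem gradient_eq_of_comp₂ {f a b : E3 → ℝ} {F : ℝ × ℝ → ℝ} {x : E3}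
    (hf : f =ᶠ[𝓝 x] fun y => F (a y, b y)) (hF : DifferentiableAt ℝ F (a x, b x))
    (ha : DifferentiableAt ℝ a x) (hb : DifferentiableAt ℝ b x) :
    gradient f x = (fderiv ℝ F (a x, b x) (1, 0)) • gradient a x + (fderiv ℝ F (a x, b x) (0, 1)) • gradient b x := by
  have hΦ : HasFDerivAt (fun y => (a y, b y)) ((fderiv ℝ a x).prod (fderiv ℝ b x)) x :=
    ha.hasFDerivAt.prodMk hb.hasFDerivAt
  have hcomp : HasFDerivAt (fun y => F (a y, b y)) ((fderiv ℝ F (a x, b x)).comp ((fderiv ℝ a x).prod (fderiv ℝ b x))) x :=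
    hF.hasFDerivAt.comp x hΦ
  have hfd : fderiv ℝ f x = (fderiv ℝ F (a x, b x)).comp ((fderiv ℝ a x).prod (fderiv ℝ b x)) := by
    rw [hf.fderiv_eq]; exact hcomp.fderiv
  apply ext_inner_right ℝ
  intro w
  rw [Literature.Analysis.FluidPDE.inner_gradient_left, hfd, inner_add_left, real_inner_smul_left, real_inner_smul_left,
    Literature.Analysis.FluidPDE.inner_gradient_left, Literature.Analysis.FluidPDE.inner_gradient_left]
  have hsplit : ((fderiv ℝ a x) w, (fderiv ℝ b x) w)
      = (fderiv ℝ a x w) • ((1 : ℝ), (0 : ℝ)) + (fderiv ℝ b x w) • ((0 : ℝ), (1 : ℝ)) := by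
    ext <;> simp
  rw [ContinuousLinearMap.comp_apply, ContinuousLinearMap.prod_apply, hsplit, map_add, map_smul, map_smul,
    smul_eq_mul, smul_eq_mul]
  ring

/-- Three vectors in the plane spanned by `p, q` have zero triple product. -/
theorem inner_cross_of_span (p q : E3) (α β γ δ ε ζ : ℝ) :
    inner ℝ (α • p + β • q) (cross (γ • p + δ • q) (ε • p + ζ • q)) = 0 := by
  simp [cross, crossProduct, EuclideanSpace.inner_eq_star_dotProduct, dotProduct, Fin.sum_univ_three,
    Matrix.vecHead, Matrix.vecTail, Function.comp_apply, Fin.succ_zero_eq_one, Fin.succ_one_eq_two]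
  ring

/-- **LEVEL CLOSURE BY INDUCTION.**  If `θ₂ = G ∘ (θ₀, θ₁)` on the open set `U` (`G` smooth on `ℝ²`, `u` smooth on `U`,
steady), then every level closes: for each `k` there is a smooth `F : ℝ² → ℝ` with `θ_k = F ∘ (θ₀, θ₁)` on `U`. -/
theorem radialJerk_levelClosure (hU : IsOpen U) (hu : ContDiffOn ℝ (⊤ : ℕ∞) u U) (x₀ : E3)
    {G : ℝ × ℝ → ℝ} (hG : ContDiff ℝ (⊤ : ℕ∞) G)
    (h2 : ∀ x ∈ U, radialJerk (fun _ : ℝ => u) x₀ 2 0 x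
      = G (radialJerk (fun _ : ℝ => u) x₀ 0 0 x, radialJerk (fun _ : ℝ => u) x₀ 1 0 x)) :
    ∀ k : ℕ, ∃ F : ℝ × ℝ → ℝ, ContDiff ℝ (⊤ : ℕ∞) F ∧
      ∀ x ∈ U, radialJerk (fun _ : ℝ => u) x₀ k 0 x
        = F (radialJerk (fun _ : ℝ => u) x₀ 0 0 x, radialJerk (fun _ : ℝ => u) x₀ 1 0 x) := by
  -- abbreviations (local, no definitions)
  have hθ : ∀ k, ContDiffOn ℝ (⊤ : ℕ∞) (radialJerk (fun _ : ℝ => u) x₀ k 0) U :=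
    contDiffOn_radialJerk_steady hU hu x₀
  have hdiff : ∀ k, ∀ x ∈ U, DifferentiableAt ℝ (radialJerk (fun _ : ℝ => u) x₀ k 0) x := fun k x hx =>
    ((hθ k).differentiableOn (by simp)).differentiableAt (hU.mem_nhds hx)
  intro k
  induction k with
  | zero => exact ⟨Prod.fst, contDiff_fst, fun x _ => rfl⟩
  | succ k ih =>
      obtain ⟨F, hF, hFeq⟩ := ih
      -- the next closure function
      refine ⟨fun p => fderiv ℝ F p (1, 0) * p.2 + fderiv ℝ F p (0, 1) * G p, ?_, ?_⟩
      · have hDF : ContDiff ℝ (⊤ : ℕ∞) (fderiv ℝ F) := hF.fderiv_right (m := (⊤ : ℕ∞)) (by exact_mod_cast le_top)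
        exact ((hDF.clm_apply contDiff_const).mul contDiff_snd).add ((hDF.clm_apply contDiff_const).mul hG)
      · intro x hx
        -- `θ_k = F ∘ (θ₀, θ₁)` near `x`, hence the gradient splits
        have hnear : radialJerk (fun _ : ℝ => u) x₀ k 0 =ᶠ[𝓝 x]
            fun y => F (radialJerk (fun _ : ℝ => u) x₀ 0 0 y, radialJerk (fun _ : ℝ => u) x₀ 1 0 y) := by
          filter_upwards [hU.mem_nhds hx] with y hy using hFeq y hy
        have hgrad := gradient_eq_of_comp₂ hnear ((hF.differentiable (by simp)) _)
          (hdiff 0 x hx) (hdiff 1 x hx)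
        rw [radialJerk_succ_steady, hgrad, inner_add_right, real_inner_smul_right, real_inner_smul_right,
          ← radialJerk_succ_steady u x₀ 0 x, ← radialJerk_succ_steady u x₀ 1 x, h2 x hx]

/-- ★ **TOWER-CLOSURE LEMMA.**  For a steady smooth drift `u` on an open set `U` and any centre `x₀`: if level two of the
radial-jerk tower closes over the first two levels, `θ₂ = G ∘ (θ₀, θ₁)` on `U` with `G ∈ C^∞(ℝ²)`, then ALL the minors
`⟪∇θ_j, ∇θ_k × ∇θ_l⟫` vanish on `U` — the tower has pointwise rank `≤ 2`.  (The «⟸» half of «rank ≤ 2 ⟺ one universal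
radial ODE along the drift»; the certification tool for closed-form candidates against `PotentialJerkRigidity`.) -/
theorem radialJerk_minors_eq_zero_of_levelTwo (hU : IsOpen U) (hu : ContDiffOn ℝ (⊤ : ℕ∞) u U) (x₀ : E3)
    {G : ℝ × ℝ → ℝ} (hG : ContDiff ℝ (⊤ : ℕ∞) G)
    (h2 : ∀ x ∈ U, radialJerk (fun _ : ℝ => u) x₀ 2 0 x
      = G (radialJerk (fun _ : ℝ => u) x₀ 0 0 x, radialJerk (fun _ : ℝ => u) x₀ 1 0 x)) :
    ∀ j k l : ℕ, ∀ x ∈ U,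
      inner ℝ (gradient (radialJerk (fun _ : ℝ => u) x₀ j 0) x)
        (cross (gradient (radialJerk (fun _ : ℝ => u) x₀ k 0) x)
          (gradient (radialJerk (fun _ : ℝ => u) x₀ l 0) x)) = 0 := by
  have hθ : ∀ k, ContDiffOn ℝ (⊤ : ℕ∞) (radialJerk (fun _ : ℝ => u) x₀ k 0) U :=
    contDiffOn_radialJerk_steady hU hu x₀
  have hdiff : ∀ k, ∀ x ∈ U, DifferentiableAt ℝ (radialJerk (fun _ : ℝ => u) x₀ k 0) x := fun k x hx =>
    ((hθ k).differentiableOn (by simp)).differentiableAt (hU.mem_nhds hx)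
  -- every gradient lies in the plane of `∇θ₀, ∇θ₁`
  have hspan : ∀ k, ∀ x ∈ U, ∃ α β : ℝ,
      gradient (radialJerk (fun _ : ℝ => u) x₀ k 0) x
        = α • gradient (radialJerk (fun _ : ℝ => u) x₀ 0 0) x + β • gradient (radialJerk (fun _ : ℝ => u) x₀ 1 0) x := by
    intro k x hx
    obtain ⟨F, hF, hFeq⟩ := radialJerk_levelClosure hU hu x₀ hG h2 k
    have hnear : radialJerk (fun _ : ℝ => u) x₀ k 0 =ᶠ[𝓝 x]
        fun y => F (radialJerk (fun _ : ℝ => u) x₀ 0 0 y, radialJerk (fun _ : ℝ => u) x₀ 1 0 y) := by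
      filter_upwards [hU.mem_nhds hx] with y hy using hFeq y hy
    exact ⟨_, _, gradient_eq_of_comp₂ hnear ((hF.differentiable (by simp)) _)
      (hdiff 0 x hx) (hdiff 1 x hx)⟩
  intro j k l x hx
  obtain ⟨α, β, hj⟩ := hspan j x hx
  obtain ⟨γ, δ, hk⟩ := hspan k x hx
  obtain ⟨ε, ζ, hl⟩ := hspan l x hx
  rw [hj, hk, hl]
  exact inner_cross_of_span _ _ α β γ δ ε ζ

/-- **Potential drifts on a ball** (the shape of `PotentialJerkRigidity`'s hypothesis).  For `h` smooth on `B(x₀, R)` with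
tower `θ_k = radialJerk (fun _ z => ∇h z) x₀ k 0`: if `θ₂ = G ∘ (θ₀, θ₁)` on the ball for a smooth `G : ℝ² → ℝ`, then
the full hypothesis of `PotentialJerkRigidity` holds there — `⟪∇θ_j, ∇θ_k × ∇θ_l⟫ = 0` for all `j, k, l`. -/
theorem potentialJerk_minors_eq_zero_of_levelTwo (h : E3 → ℝ) (x₀ : E3) {R : ℝ}
    (hh : ContDiffOn ℝ (⊤ : ℕ∞) h (Metric.ball x₀ R)) {G : ℝ × ℝ → ℝ} (hG : ContDiff ℝ (⊤ : ℕ∞) G)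
    (h2 : ∀ x ∈ Metric.ball x₀ R, radialJerk (fun (_ : ℝ) (z : E3) => gradient h z) x₀ 2 0 x
      = G (radialJerk (fun (_ : ℝ) (z : E3) => gradient h z) x₀ 0 0 x,
           radialJerk (fun (_ : ℝ) (z : E3) => gradient h z) x₀ 1 0 x)) :
    ∀ j k l : ℕ, ∀ x ∈ Metric.ball x₀ R,
      inner ℝ (gradient (radialJerk (fun (_ : ℝ) (z : E3) => gradient h z) x₀ j 0) x)
        (cross (gradient (radialJerk (fun (_ : ℝ) (z : E3) => gradient h z) x₀ k 0) x)
          (gradient (radialJerk (fun (_ : ℝ) (z : E3) => gradient h z) x₀ l 0) x)) = 0 :=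
  radialJerk_minors_eq_zero_of_levelTwo (u := fun z => gradient h z) Metric.isOpen_ball
    (Literature.Analysis.FluidPDE.contDiffOn_gradient_of_isOpen Metric.isOpen_ball hh) x₀ hG h2

end TowerClosure

end Summit.NavierStokesRegularity.NavierStokesRegularity.Theorems.PoloidalLiouville.ErtelTower
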